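import Summits.NavierStokesRegularity.OSWSelfSimilar.SheetRPerturbedResolventIdentity
import HarnessLib

/-!
# SHEET-ℝ frame, (P1) for the FULL operator `A = (−∂² + d∂ + V) + K`: the SHARP pivot bound `‖R_K(σ)‖ ≤ 1/(m + Re σ)`
# (cert-1's `‖𝒜(σ)⁻¹J‖_{w→w} ≤ 1/c_w(σ)` for `A_F = B_λ − P + F`, the constant the S2 step rule uses)

HONEST FRAMING (cell ns-blowup GROUP B / zone Z3, case Z3-SR-SPEC, PAPER item (P1) / (S1) output «`‖𝒜(σ)⁻¹J‖_{w→w} ≤ 1/(c₁ + γ + Re σ)`» of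
SHEET-R-SPEC-PRICE-impl1; 1-D MODEL certificate frame (viscous gCLM/OSW sheet on the line); not Euler/NS; «violates: none — MODEL»). Nothing here asserts
that a profile exists; the Gårding datum of the perturbed form ((S1)) is the HYPOTHESIS `GardingDataK`; `K : Esp L hL →L[ℝ] W L` arbitrary bounded.

`SheetRPerturbedResolvent.norm_resolventK_le` has the Lions constant `8/κ(σ)`.  The sharp constant comes, as in `SheetRResolventBounds`, from the energy
identity for the ACTUAL solution pair, now with the commutator error of `SheetRPerturbedUniqueness` (which tends to zero): `cutoff_ineq_K_pivot`,
`pair_pivot_le_of_weakK` (`c(‖u_R‖²_w + ‖u_I‖²_w) ≤ ‖g_R‖‖u_R‖ + ‖g_I‖‖u_I‖`), `pivot_coerciveK_shift` (`(m + s)‖v‖²_w ≤` perturbed shifted form), and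
**`norm_resolventK_le_inv`: `‖resolventK σ G‖ ≤ ‖G‖/(m + Re σ)` on `Re σ > −m`**.
Pure functional analysis; no definition, no named fact.  WHAT THIS IS NOT: not NS; no number of record moves.
-/

noncomputable section

namespace Summit.NavierStokesRegularity.OSWSelfSimilar
namespace SheetRPerturbedResolventBounds

open _root_.MeasureTheory _root_.Set _root_.Filter _root_.Real SheetRWeakProfilePV SheetRWeakToStrong SheetREnergyClass SheetRWeightedMeasure
  SheetRLinearisedTests SheetREnergySpace SheetRTestSpace SheetRLinearisedFormBounds SheetRSolutionOperator SheetRLinearisedCutoffEstimates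
  SheetRLinearisedCutoffEnergy SheetRLinearisedUniqueness SheetRResolventPair SheetRComplexPivot SheetRResolventComplex SheetRResolventBounds
  SheetRCutoffApproximation SheetRPerturbedUniqueness SheetRPerturbedPair SheetRPerturbedResolvent
open scoped Topology ENNReal

variable {L D₀ D₁ V₀ m : ℝ} {d V : ℝ → ℝ}

/-! ### §1 The pivot cutoff inequality with `K` -/

/-- **The perturbed cutoff inequality, PIVOT version.**  If the perturbed form is `c`-coercive in the pivot norm on tests
(`c‖v‖²_w ≤ linForm(v; v) + ∫ w K(jmap v)·v`), then for `p ∈ Esp`, `R ≥ 1`, `|χ_R′| ≤ M/R`: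
`c·∫_{ξ²<R²} w u² ≤ [linForm(u; χ_R²u) + ∫ w (Kp)·χ_R²u] + C·∫_{R²≤ξ²} w u² + err(R)` with the `err` of
`SheetRPerturbedUniqueness.cutoff_ineq_K`. [folklore] -/
theorem cutoff_ineq_K_pivot (hL : 0 < L) (hdm : AEStronglyMeasurable d volume) (hVm : AEStronglyMeasurable V volume)
    (hD₀ : 0 ≤ D₀) (hD₁ : 0 ≤ D₁) (hd : ∀ ξ, |d ξ| ≤ D₀ + D₁ * |ξ|) (hV : ∀ ξ, |V ξ| ≤ V₀)
    (K : Esp L hL →L[ℝ] W L) {c : ℝ} (hc : 0 < c)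
    (hcoerW : ∀ vp : testSpace, c * ∫ ξ, (L ^ 2 + ξ ^ 2) * vp.1.1 ξ ^ 2 ≤
      linForm L d V vp.1.1 vp.1.2 vp.1.1 vp.1.2 + ∫ y, (L ^ 2 + y ^ 2) * (((K (jmap hL vp) : W L) : ℝ → ℝ) y * vp.1.1 y))
    (p : Esp L hL) {M : ℝ} (hM0 : 0 ≤ M) {R : ℝ} (hR : 1 ≤ R) (hM : ∀ ξ : ℝ, |deriv (cutoff R) ξ| ≤ M / R) :
    c * ∫ ξ in {ξ : ℝ | R ^ 2 ≤ ξ ^ 2}ᶜ, (L ^ 2 + ξ ^ 2) * prim (der p) ξ ^ 2 ≤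
      (linForm L d V (prim (der p)) (der p) (fun ξ => cutoff R ξ * (cutoff R ξ * prim (der p) ξ))
          (fun ξ => deriv (cutoff R) ξ * (cutoff R ξ * prim (der p) ξ) + cutoff R ξ * (deriv (cutoff R) ξ * prim (der p) ξ + cutoff R ξ * der p ξ))
        + ∫ y, (L ^ 2 + y ^ 2) * (((K p : W L) : ℝ → ℝ) y * (cutoff R y * (cutoff R y * prim (der p) y))))
      + (M ^ 2 + 4 * M / L ^ 2 + M * (D₀ + 2 * D₁)) * (∫ ξ in {ξ : ℝ | R ^ 2 ≤ ξ ^ 2}, (L ^ 2 + ξ ^ 2) * prim (der p) ξ ^ 2)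
      + (‖K‖ * Real.sqrt ((1 / 4 + 2 * M ^ 2) * (∫ y in {ξ : ℝ | R ^ 2 ≤ ξ ^ 2}, (L ^ 2 + y ^ 2) * prim (der p) y ^ 2)
            + 2 * ∫ y in {ξ : ℝ | R ^ 2 ≤ ξ ^ 2}, (L ^ 2 + y ^ 2) * der p y ^ 2)
          + Real.sqrt (∫ y in {ξ : ℝ | R ^ 2 ≤ ξ ^ 2}, (L ^ 2 + y ^ 2) * ((K p : W L) : ℝ → ℝ) y ^ 2))
        * Real.sqrt (∫ y, (L ^ 2 + y ^ 2) * prim (der p) y ^ 2) := by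
  have hR0 : 0 < R := by linarith
  obtain ⟨hu', hodd', hu₁m', h0', h1', -, -⟩ := energyClass_of_mem hL p
  have hu : ∀ x, prim (der p) x = prim (der p) 0 + ∫ s in (0 : ℝ)..x, der p s := hu'
  have hodd : ∀ y, prim (der p) (-y) = -prim (der p) y := hodd'
  have hu₁m : AEStronglyMeasurable (der p) volume := hu₁m'
  have h0 : Integrable fun y => (L ^ 2 + y ^ 2) * prim (der p) y ^ 2 := h0'
  have h1 : Integrable fun y => (L ^ 2 + y ^ 2) * der p y ^ 2 := h1'
  obtain ⟨huc, hu₁2, hu2, -, -⟩ := basic_of_primitive hL hu hu₁m h0 h1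
  -- the cutoff test `τ` and the double cutoff test
  obtain ⟨hτ, -⟩ := isCompactTest_cutoff_mul hR0 hu hodd hu₁2 hu2
  have hτ2 := isCompactTest_cutoff_sq_mul hR0 hu hodd hu₁2 hu2
  set τ : testSpace := ⟨(fun ξ => cutoff R ξ * prim (der p) ξ, fun ξ => deriv (cutoff R) ξ * prim (der p) ξ + cutoff R ξ * der p ξ), hτ⟩
    with hτdef
  -- (1) coercivity on `τ`
  have hco := hcoerW τ
  -- (2) the local cutoff inequality
  have hcut := linForm_cutoff_le hL hdm hVm hD₀ hD₁ hd hV hu hu₁m h0 h1 hM0 hR hM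
  -- (3) the `K`-terms: `∫ w K(jmap τ)·χu = ∫ w (Kp)·χ²u + commutator`
  obtain ⟨hcomm_int, hcomm_le⟩ := abs_commutator_le hL hR0 (K p) (K (jmap hL τ)) huc h0
  have hKp_int := integrable_weight_mul_test hL (K p) hτ2
  have hsplit : ∫ y, (L ^ 2 + y ^ 2) * (((K (jmap hL τ) : W L) : ℝ → ℝ) y * (τ : (ℝ → ℝ) × (ℝ → ℝ)).1 y) =
      (∫ y, (L ^ 2 + y ^ 2) * (((K p : W L) : ℝ → ℝ) y * (cutoff R y * (cutoff R y * prim (der p) y))))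
        + ∫ y, (L ^ 2 + y ^ 2) * ((((K (jmap hL τ) : W L) : ℝ → ℝ) y - cutoff R y * ((K p : W L) : ℝ → ℝ) y)
            * (cutoff R y * prim (der p) y)) := by
    rw [← integral_add hKp_int hcomm_int]
    refine integral_congr_ae (Eventually.of_forall fun y => ?_)
    show (L ^ 2 + y ^ 2) * (((K (jmap hL τ) : W L) : ℝ → ℝ) y * (cutoff R y * prim (der p) y)) = _
    ring
  -- (4) the commutator size: `‖K(jmap τ) − Kp‖ ≤ ‖K‖·‖jmap τ − p‖ ≤ ‖K‖·√(...)`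
  have hKdiff : ‖K (jmap hL τ) - K p‖ ≤ ‖K‖ * Real.sqrt ((1 / 4 + 2 * M ^ 2) * (∫ y in {ξ : ℝ | R ^ 2 ≤ ξ ^ 2}, (L ^ 2 + y ^ 2) * prim (der p) y ^ 2)
      + 2 * ∫ y in {ξ : ℝ | R ^ 2 ≤ ξ ^ 2}, (L ^ 2 + y ^ 2) * der p y ^ 2) := by
    rw [← map_sub]
    refine (K.le_opNorm _).trans (mul_le_mul_of_nonneg_left ?_ (norm_nonneg K))
    have hsq := sq_norm_jmap_cutoff_sub_le hL p hR hM0 hM hτ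
    calc ‖jmap hL τ - p‖ = Real.sqrt (‖jmap hL τ - p‖ ^ 2) := (Real.sqrt_sq (norm_nonneg _)).symm
      _ ≤ _ := Real.sqrt_le_sqrt hsq
  -- (5) lower bound from the `jmap` norm and the plateau
  have hjn := sq_norm_jmap hL τ
  have hplat := (plateau_mass_le (L := L) hR0 huc h0).2
  have hv₁nn : 0 ≤ ∫ y, (L ^ 2 + y ^ 2) * (τ : (ℝ → ℝ) × (ℝ → ℝ)).2 y ^ 2 := integral_nonneg fun y => by positivity
  have hτ1 : (τ : (ℝ → ℝ) × (ℝ → ℝ)).1 = fun ξ => cutoff R ξ * prim (der p) ξ := rfl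
  rw [hτ1] at hjn
  -- assemble
  have hcomm_le' : |∫ y, (L ^ 2 + y ^ 2) * ((((K (jmap hL τ) : W L) : ℝ → ℝ) y - cutoff R y * ((K p : W L) : ℝ → ℝ) y)
      * (cutoff R y * prim (der p) y))| ≤
      (‖K‖ * Real.sqrt ((1 / 4 + 2 * M ^ 2) * (∫ y in {ξ : ℝ | R ^ 2 ≤ ξ ^ 2}, (L ^ 2 + y ^ 2) * prim (der p) y ^ 2)
            + 2 * ∫ y in {ξ : ℝ | R ^ 2 ≤ ξ ^ 2}, (L ^ 2 + y ^ 2) * der p y ^ 2)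
          + Real.sqrt (∫ y in {ξ : ℝ | R ^ 2 ≤ ξ ^ 2}, (L ^ 2 + y ^ 2) * ((K p : W L) : ℝ → ℝ) y ^ 2))
        * Real.sqrt (∫ y, (L ^ 2 + y ^ 2) * prim (der p) y ^ 2) := by
    refine hcomm_le.trans (mul_le_mul_of_nonneg_right (add_le_add hKdiff le_rfl) (Real.sqrt_nonneg _))
  have hab := le_abs_self (∫ y, (L ^ 2 + y ^ 2) * ((((K (jmap hL τ) : W L) : ℝ → ℝ) y - cutoff R y * ((K p : W L) : ℝ → ℝ) y)
      * (cutoff R y * prim (der p) y)))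
  rw [hsplit] at hco
  have hE : linForm L d V (τ : (ℝ → ℝ) × (ℝ → ℝ)).1 (τ : (ℝ → ℝ) × (ℝ → ℝ)).2 (τ : (ℝ → ℝ) × (ℝ → ℝ)).1 (τ : (ℝ → ℝ) × (ℝ → ℝ)).2 =
      linForm L d V (fun ξ => cutoff R ξ * prim (der p) ξ) (fun ξ => deriv (cutoff R) ξ * prim (der p) ξ + cutoff R ξ * der p ξ)
        (fun ξ => cutoff R ξ * prim (der p) ξ) (fun ξ => deriv (cutoff R) ξ * prim (der p) ξ + cutoff R ξ * der p ξ) := rfl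
  rw [hE] at hco
  nlinarith [mul_le_mul_of_nonneg_left hplat hc.le]


/-! ### §2 The pivot inequality for a perturbed weak solution PAIR -/

/-- **Pivot inequality for the perturbed skew-coupled pair.**  `p_R, p_I ∈ Esp` solving
`linForm(u_R; φ) + ∫w(Kp_R)φ − t∫w u_I φ = ∫w g_R φ`, `linForm(u_I; φ) + ∫w(Kp_I)φ + t∫w u_R φ = ∫w g_I φ` on every compactly supported test
(`g_R, g_I ∈ L²_w`), with the perturbed form `c`-coercive in the pivot norm on tests (`c > 0`):
`c(‖u_R‖²_w + ‖u_I‖²_w) ≤ ‖g_R‖_w‖u_R‖_w + ‖g_I‖_w‖u_I‖_w`. [folklore] -/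
theorem pair_pivot_le_of_weakK (hL : 0 < L) (hdm : AEStronglyMeasurable d volume) (hVm : AEStronglyMeasurable V volume)
    (hD₀ : 0 ≤ D₀) (hD₁ : 0 ≤ D₁) (hd : ∀ ξ, |d ξ| ≤ D₀ + D₁ * |ξ|) (hV : ∀ ξ, |V ξ| ≤ V₀)
    (K : Esp L hL →L[ℝ] W L) {c : ℝ} (hc : 0 < c)
    (hcoerW : ∀ vp : testSpace, c * ∫ ξ, (L ^ 2 + ξ ^ 2) * vp.1.1 ξ ^ 2 ≤
      linForm L d V vp.1.1 vp.1.2 vp.1.1 vp.1.2 + ∫ y, (L ^ 2 + y ^ 2) * (((K (jmap hL vp) : W L) : ℝ → ℝ) y * vp.1.1 y))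
    {pR pI : Esp L hL} (gR gI : W L) (t : ℝ)
    (hweakR : ∀ v v₁ : ℝ → ℝ, IsCompactTest v v₁ →
      linForm L d V (prim (der pR)) (der pR) v v₁ + (∫ y, (L ^ 2 + y ^ 2) * (((K pR : W L) : ℝ → ℝ) y * v y))
        - t * ∫ y, (L ^ 2 + y ^ 2) * (prim (der pI) y * v y) = ∫ y, (L ^ 2 + y ^ 2) * ((gR : ℝ → ℝ) y * v y))
    (hweakI : ∀ v v₁ : ℝ → ℝ, IsCompactTest v v₁ →
      linForm L d V (prim (der pI)) (der pI) v v₁ + (∫ y, (L ^ 2 + y ^ 2) * (((K pI : W L) : ℝ → ℝ) y * v y))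
        + t * ∫ y, (L ^ 2 + y ^ 2) * (prim (der pR) y * v y) = ∫ y, (L ^ 2 + y ^ 2) * ((gI : ℝ → ℝ) y * v y)) :
    c * ((∫ ξ, (L ^ 2 + ξ ^ 2) * prim (der pR) ξ ^ 2) + ∫ ξ, (L ^ 2 + ξ ^ 2) * prim (der pI) ξ ^ 2) ≤
      ‖gR‖ * Real.sqrt (∫ ξ, (L ^ 2 + ξ ^ 2) * prim (der pR) ξ ^ 2) + ‖gI‖ * Real.sqrt (∫ ξ, (L ^ 2 + ξ ^ 2) * prim (der pI) ξ ^ 2) := by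
  obtain ⟨huR', hoddR', huR₁m', h0R', h1R', -, -⟩ := energyClass_of_mem hL pR
  have huR : ∀ x, prim (der pR) x = prim (der pR) 0 + ∫ s in (0 : ℝ)..x, der pR s := huR'
  have hoddR : ∀ y, prim (der pR) (-y) = -prim (der pR) y := hoddR'
  have huR₁m : AEStronglyMeasurable (der pR) volume := huR₁m'
  have h0R : Integrable fun y => (L ^ 2 + y ^ 2) * prim (der pR) y ^ 2 := h0R'
  have h1R : Integrable fun y => (L ^ 2 + y ^ 2) * der pR y ^ 2 := h1R'
  obtain ⟨huRc, huR₁2, huR2, -, -⟩ := basic_of_primitive hL huR huR₁m h0R h1R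
  obtain ⟨huI', hoddI', huI₁m', h0I', h1I', -, -⟩ := energyClass_of_mem hL pI
  have huI : ∀ x, prim (der pI) x = prim (der pI) 0 + ∫ s in (0 : ℝ)..x, der pI s := huI'
  have hoddI : ∀ y, prim (der pI) (-y) = -prim (der pI) y := hoddI'
  have huI₁m : AEStronglyMeasurable (der pI) volume := huI₁m'
  have h0I : Integrable fun y => (L ^ 2 + y ^ 2) * prim (der pI) y ^ 2 := h0I'
  have h1I : Integrable fun y => (L ^ 2 + y ^ 2) * der pI y ^ 2 := h1I'
  obtain ⟨huIc, huI₁2, huI2, -, -⟩ := basic_of_primitive hL huI huI₁m h0I h1I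
  obtain ⟨M, hM0, hM⟩ := exists_deriv_cutoff_le
  obtain ⟨C, hC⟩ : ∃ C : ℝ, C = M ^ 2 + 4 * M / L ^ 2 + M * (D₀ + 2 * D₁) := ⟨_, rfl⟩
  set IR : ℝ := ∫ ξ, (L ^ 2 + ξ ^ 2) * prim (der pR) ξ ^ 2 with hIR
  set II : ℝ := ∫ ξ, (L ^ 2 + ξ ^ 2) * prim (der pI) ξ ^ 2 with hII
  set A : ℝ := ‖gR‖ * Real.sqrt IR + ‖gI‖ * Real.sqrt II with hA
  set TR : ℕ → ℝ := fun n => ∫ ξ in {ξ : ℝ | ((n : ℝ) + 1) ^ 2 ≤ ξ ^ 2}, (L ^ 2 + ξ ^ 2) * prim (der pR) ξ ^ 2 with hTR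
  set TI : ℕ → ℝ := fun n => ∫ ξ in {ξ : ℝ | ((n : ℝ) + 1) ^ 2 ≤ ξ ^ 2}, (L ^ 2 + ξ ^ 2) * prim (der pI) ξ ^ 2 with hTI
  set ER : ℕ → ℝ := fun n =>
      C * (∫ ξ in {ξ : ℝ | ((n : ℝ) + 1) ^ 2 ≤ ξ ^ 2}, (L ^ 2 + ξ ^ 2) * prim (der pR) ξ ^ 2)
      + (‖K‖ * Real.sqrt ((1 / 4 + 2 * M ^ 2) * (∫ y in {ξ : ℝ | ((n : ℝ) + 1) ^ 2 ≤ ξ ^ 2}, (L ^ 2 + y ^ 2) * prim (der pR) y ^ 2)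
            + 2 * ∫ y in {ξ : ℝ | ((n : ℝ) + 1) ^ 2 ≤ ξ ^ 2}, (L ^ 2 + y ^ 2) * der pR y ^ 2)
          + Real.sqrt (∫ y in {ξ : ℝ | ((n : ℝ) + 1) ^ 2 ≤ ξ ^ 2}, (L ^ 2 + y ^ 2) * ((K pR : W L) : ℝ → ℝ) y ^ 2))
        * Real.sqrt (∫ y, (L ^ 2 + y ^ 2) * prim (der pR) y ^ 2) with hER
  set EI : ℕ → ℝ := fun n =>
      C * (∫ ξ in {ξ : ℝ | ((n : ℝ) + 1) ^ 2 ≤ ξ ^ 2}, (L ^ 2 + ξ ^ 2) * prim (der pI) ξ ^ 2)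
      + (‖K‖ * Real.sqrt ((1 / 4 + 2 * M ^ 2) * (∫ y in {ξ : ℝ | ((n : ℝ) + 1) ^ 2 ≤ ξ ^ 2}, (L ^ 2 + y ^ 2) * prim (der pI) y ^ 2)
            + 2 * ∫ y in {ξ : ℝ | ((n : ℝ) + 1) ^ 2 ≤ ξ ^ 2}, (L ^ 2 + y ^ 2) * der pI y ^ 2)
          + Real.sqrt (∫ y in {ξ : ℝ | ((n : ℝ) + 1) ^ 2 ≤ ξ ^ 2}, (L ^ 2 + y ^ 2) * ((K pI : W L) : ℝ → ℝ) y ^ 2))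
        * Real.sqrt (∫ y, (L ^ 2 + y ^ 2) * prim (der pI) y ^ 2) with hEI
  have hstep : ∀ n : ℕ, c * (IR + II) ≤ A + c * (TR n + TI n) + (ER n + EI n) := by
    intro n
    have hR : (1 : ℝ) ≤ (n : ℝ) + 1 := by
      have : (0 : ℝ) ≤ n := Nat.cast_nonneg n
      linarith
    have hR0 : (0 : ℝ) < (n : ℝ) + 1 := by linarith
    have hmeas : MeasurableSet {ξ : ℝ | ((n : ℝ) + 1) ^ 2 ≤ ξ ^ 2} := measurableSet_le measurable_const (by fun_prop)
    have hRi := cutoff_ineq_K_pivot hL hdm hVm hD₀ hD₁ hd hV K hc hcoerW pR hM0 hR (hM _ hR0)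
    have hIi := cutoff_ineq_K_pivot hL hdm hVm hD₀ hD₁ hd hV K hc hcoerW pI hM0 hR (hM _ hR0)
    rw [← hC] at hRi hIi
    have hτR2 := isCompactTest_cutoff_sq_mul hR0 huR hoddR huR₁2 huR2
    have hτI2 := isCompactTest_cutoff_sq_mul hR0 huI hoddI huI₁2 huI2
    have eR := hweakR _ _ hτR2
    have eI := hweakI _ _ hτI2
    have hcross : ∫ y, (L ^ 2 + y ^ 2) * (prim (der pI) y * (cutoff ((n : ℝ) + 1) y * (cutoff ((n : ℝ) + 1) y * prim (der pR) y))) =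
        ∫ y, (L ^ 2 + y ^ 2) * (prim (der pR) y * (cutoff ((n : ℝ) + 1) y * (cutoff ((n : ℝ) + 1) y * prim (der pI) y))) :=
      integral_congr_ae (Eventually.of_forall fun y => by ring)
    have eR' := eq_add_of_sub_eq eR
    have eI' := eq_sub_of_add_eq eI
    rw [eR', hcross] at hRi
    rw [eI'] at hIi
    have hdatR := abs_data_cutoff_le (L := L) ((n : ℝ) + 1) (aestronglyMeasurable_of_W hL gR) (weightedSq_of_W hL gR) huRc h0R
    have hdatI := abs_data_cutoff_le (L := L) ((n : ℝ) + 1) (aestronglyMeasurable_of_W hL gI) (weightedSq_of_W hL gI) huIc h0I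
    rw [← norm_W] at hdatR hdatI
    have habR := le_abs_self (∫ y, (L ^ 2 + y ^ 2) * ((gR : ℝ → ℝ) y * (cutoff ((n : ℝ) + 1) y * (cutoff ((n : ℝ) + 1) y * prim (der pR) y))))
    have habI := le_abs_self (∫ y, (L ^ 2 + y ^ 2) * ((gI : ℝ → ℝ) y * (cutoff ((n : ℝ) + 1) y * (cutoff ((n : ℝ) + 1) y * prim (der pI) y))))
    have hsR : ∫ ξ in {ξ : ℝ | ((n : ℝ) + 1) ^ 2 ≤ ξ ^ 2}ᶜ, (L ^ 2 + ξ ^ 2) * prim (der pR) ξ ^ 2 = IR - TR n := by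
      rw [hIR, hTR, ← integral_add_compl hmeas h0R]; ring
    have hsI : ∫ ξ in {ξ : ℝ | ((n : ℝ) + 1) ^ 2 ≤ ξ ^ 2}ᶜ, (L ^ 2 + ξ ^ 2) * prim (der pI) ξ ^ 2 = II - TI n := by
      rw [hII, hTI, ← integral_add_compl hmeas h0I]; ring
    rw [hsR] at hRi
    rw [hsI] at hIi
    have h1 : c * (IR - TR n) + c * (II - TI n) ≤ A + (ER n + EI n) := by
      simp only [hER, hEI, hA]
      linarith
    linarith
  have hlim : Tendsto (fun n : ℕ => A + c * (TR n + TI n) + (ER n + EI n)) atTop (𝓝 (A + c * (0 + 0) + (0 + 0))) :=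
    (tendsto_const_nhds.add (((tendsto_tail h0R).add (tendsto_tail h0I)).const_mul _)).add
      ((tendsto_err hL K pR M C).add (tendsto_err hL K pI M C))
  simp only [add_zero, mul_zero] at hlim
  exact ge_of_tendsto' hlim hstep

/-! ### §3 The sharp bound for the perturbed complex resolvent -/

/-- **Pivot coercivity of the shifted perturbed form**: `(m + s)‖v‖²_w ≤ linForm L d (V + s) v v₁ v v₁ + ∫ w K(jmap v)·v`. [folklore] -/
theorem pivot_coerciveK_shift {hL : 0 < L} {K : Esp L hL →L[ℝ] W L} (h : GardingDataK L hL d V K D₀ D₁ V₀ m) (s : ℝ) (vp : testSpace) :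
    (m + s) * ∫ ξ, (L ^ 2 + ξ ^ 2) * vp.1.1 ξ ^ 2 ≤
      linForm L d (fun ξ => V ξ + s) vp.1.1 vp.1.2 vp.1.1 vp.1.2
        + ∫ y, (L ^ 2 + y ^ 2) * (((K (jmap hL vp) : W L) : ℝ → ℝ) y * vp.1.1 y) := by
  obtain ⟨hc, -, -, -⟩ := basic_of_isCompactTest vp.2
  obtain ⟨hwv, hwv₁⟩ := weighted_of_isCompactTest (L := L) vp.2
  obtain ⟨hint, -⟩ := abs_linForm_le hL h.d_meas h.V_meas h.D₁_nonneg h.d_le h.V_le vp.2 hc.aestronglyMeasurable vp.2.memLp.1 hwv hwv₁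
  have hshift : linForm L d (fun ξ => V ξ + s) vp.1.1 vp.1.2 vp.1.1 vp.1.2 =
      linForm L d V vp.1.1 vp.1.2 vp.1.1 vp.1.2 + s * ∫ y, (L ^ 2 + y ^ 2) * vp.1.1 y ^ 2 := by
    unfold linForm
    rw [← integral_const_mul, ← integral_add hint (hwv.const_mul s)]
    refine integral_congr_ae (Eventually.of_forall fun y => ?_)
    ring
  rw [hshift]
  have hG := h.garding vp
  have hn1 : 0 ≤ ∫ ξ, (L ^ 2 + ξ ^ 2) * vp.1.2 ξ ^ 2 := integral_nonneg fun y => by positivity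
  nlinarith

/-- **`‖R_K(σ)G‖ ≤ ‖G‖/(m + Re σ)`** on the half-plane `Re σ > −m`. [folklore] -/
theorem norm_resolventK_le_inv (hL : 0 < L) (K : Esp L hL →L[ℝ] W L) (h : GardingDataK L hL d V K D₀ D₁ V₀ m) {σ : ℂ} (hσ : -m < σ.re)
    (G : Wc L) : ‖resolventK hL K h σ G‖ ≤ ‖G‖ / (m + σ.re) := by
  have hc : 0 < m + σ.re := by linarith
  obtain ⟨happ, -, -, hweak⟩ := resolventK_weak hL K h hσ G
  set P := pairOpK hL K h σ hσ (toPair L G) with hP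
  obtain ⟨hVs, hVb⟩ := shift_hypsK h σ.re
  obtain ⟨hGf, hGs⟩ := toPair_fst_snd G
  have hpair := pair_pivot_le_of_weakK hL h.d_meas hVs h.D₀_nonneg h.D₁_nonneg h.d_le hVb K hc (pivot_coerciveK_shift h σ.re)
    (pR := P.fst) (pI := P.snd) (reW L G) (imW L G) σ.im (fun v v₁ hv => (hweak v v₁ hv).1) (fun v v₁ hv => (hweak v v₁ hv).2)
  set IR : ℝ := ∫ ξ, (L ^ 2 + ξ ^ 2) * prim (der P.fst) ξ ^ 2 with hIR
  set II : ℝ := ∫ ξ, (L ^ 2 + ξ ^ 2) * prim (der P.snd) ξ ^ 2 with hII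
  have hIRnn : 0 ≤ IR := integral_nonneg fun ξ => by positivity
  have hIInn : 0 ≤ II := integral_nonneg fun ξ => by positivity
  have hnormR : ‖resolventK hL K h σ G‖ = Real.sqrt (IR + II) := by
    rw [happ, norm_ofPair]
    obtain ⟨h1, h2⟩ := ιpair_fst_snd hL P
    have hsq : ‖ιpair hL P‖ ^ 2 = IR + II := by
      rw [WithLp.prod_norm_sq_eq_of_L2, h1, h2, (norm_ιE_le hL P.fst).1, (norm_ιE_le hL P.snd).1, Real.sq_sqrt hIRnn,
        Real.sq_sqrt hIInn]
    rw [← hsq, Real.sqrt_sq (norm_nonneg _)]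
  have hnormG : ‖G‖ = Real.sqrt (‖reW L G‖ ^ 2 + ‖imW L G‖ ^ 2) := by
    rw [← norm_toPair G]
    obtain ⟨h1, h2⟩ := toPair_fst_snd G
    have hsq : ‖toPair L G‖ ^ 2 = ‖reW L G‖ ^ 2 + ‖imW L G‖ ^ 2 := by rw [WithLp.prod_norm_sq_eq_of_L2, h1, h2]
    rw [← hsq, Real.sqrt_sq (norm_nonneg _)]
  have hcs : ‖reW L G‖ * Real.sqrt IR + ‖imW L G‖ * Real.sqrt II ≤ Real.sqrt (‖reW L G‖ ^ 2 + ‖imW L G‖ ^ 2) * Real.sqrt (IR + II) := by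
    have := sqrt_mul_add_sqrt_mul_le (sq_nonneg ‖reW L G‖) (sq_nonneg ‖imW L G‖) hIRnn hIInn
    rwa [Real.sqrt_sq (norm_nonneg _), Real.sqrt_sq (norm_nonneg _)] at this
  have hmain : (m + σ.re) * (IR + II) ≤ ‖G‖ * Real.sqrt (IR + II) := by
    rw [hnormG]; exact hpair.trans hcs
  rw [hnormR, le_div_iff₀ hc]
  rcases (Real.sqrt_nonneg (IR + II)).eq_or_lt with hz | hpos
  · rw [← hz, zero_mul]; exact norm_nonneg _
  · have h2 : (m + σ.re) * Real.sqrt (IR + II) * Real.sqrt (IR + II) ≤ ‖G‖ * Real.sqrt (IR + II) := by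
      rw [mul_assoc, Real.mul_self_sqrt (by positivity)]; exact hmain
    have := le_of_mul_le_mul_right h2 hpos
    linarith

end SheetRPerturbedResolventBounds
end Summit.NavierStokesRegularity.OSWSelfSimilar

end
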